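import Summits.ValiantsHypothesis.ValiantsHypothesis.Theorems.LacunarySymmetroidMatrixDescartesCensusDoorA34SheetWindowOrdered

/-!
# `MatrixDescartes` census — DOOR A at `(3,4)`: window-ordered supports in the chamber `3·d₁ < 2·d₀ + d₂` (all rails `(0,1,b,N)`, `b ≥ 4`, `N > 3b`, in
# particular the `(0,1,4,N)` rail of every null-top seventeen and eighteen-design of record) — an INDEFINITE rank-two top letter forces the MIDDLE letter `S₁`
# to be non-definite as well

HONEST FRAMING.  Object-search cell `pub-symmetroid`, engine seat `val-sym-eng-2` (g4); helper row beside the registered strata line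
`Cruxes/DoorA34/Lines/strata.lean` on stmt-ValiantsHypothesis-19980 (`DoorA34 = PosRootLawAt 3 4 18`: OPEN, typed, never asserted here).  Companion of
…SheetWindowOrdered (indefinite top ⇒ `S₀` non-definite on every window-ordered support).  The TOP TEST of a letter `x` only depends on the PARITY of
`ρ(3d_x) + ρ(2d₃ + d_x)` (the middle rank cancels mod 2).  For `x = 1`: `ρ(2d₃ + d₁) = 17` on every window-ordered support (`sheetRank_topMiddle_of_windowOrdered`),
and `ρ(3d₁) = 3` as soon as `3·d₁ < 2·d₀ + d₂` (`sheetRank_coreMiddle_of_chamber`: below `3d₁` lie exactly `{0,0,0}, {0,0,1}, {0,1,1}`); the sum `20` is EVEN,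
while the indefinite cell (`−adj S₃ ⪰ 0`) demands an ODD top test for a definite letter:

* `sym_sum_lt_three_d1_iff`-type bounds (`sym_sum_lt_three_d1`, `sym_sum_ge_three_d1`, `sym_sum_lt_topMiddle`, `sym_sum_ge_topMiddle`), `decide` counts `3` / `17`;
* **`card_posRoots_le_17_of_windowOrdered_chamber_indefTop_definiteMiddle`** — `StrictMono d`, `3·d 2 < d 3`, `3·d 1 < 2·d 0 + d 2`, `det S₃ = 0`, `−adj S₃ ⪰ 0`,
  `S₁` definite ⇒ `Z₊ ≤ 17`.  With …SheetWindowOrdered: on these rails a null-top eighteen with indefinite top letter has `S₀` AND `S₁` non-definite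
  (`S₂` may be definite — the located test allows it).

Nothing here bounds anything else; `DoorA34` and the three stubs stay OPEN; registers unchanged; nothing on `MatrixDescartes` (stmt-ValiantsHypothesis-18050) or
`VP ≠ VNP` — VP≠VNP not moved.  [folklore] Descartes (sharp case) bookkeeping; elementary.
-/

-- `Summit.ValiantsHypothesis.ValiantsHypothesis.…` repeats a component by the D-0017 layout
-- (single-conjunct summit), which the `dupNamespace` linter flags; the name is mandated.
set_option linter.dupNamespace false

namespace Summit.ValiantsHypothesis.ValiantsHypothesis.Theorems.LacunarySymmetroidMatrixDescartes.Census

open Polynomial Finset Matrix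
open scoped BigOperators Polynomial Matrix

/-! ## 1. Block bounds around `3d₁` and `2d₃ + d₁` -/

/-- Slots below `3d₁`: no `3`, no `2`, not `{1,1,1}` (chamber `3d₁ < 2d₀ + d₂` not even needed for this direction). [folklore] -/
theorem sym_sum_lt_three_d1 (d : Fin 4 → ℕ) (hd : StrictMono d) (s : Sym (Fin 4) 3) (h3 : (3 : Fin 4) ∉ (s : Multiset (Fin 4)))
    (h2 : (2 : Fin 4) ∉ (s : Multiset (Fin 4))) (h1 : s ≠ Sym.replicate 3 1) : ((s : Multiset (Fin 4)).map d).sum < 3 * d 1 := by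
  have h01 : d 0 < d 1 := hd (by decide)
  have hle1 : ∀ l : Fin 4, l ≠ 3 → l ≠ 2 → d l ≤ d 1 := fun l hl hl2 => hd.monotone (by
    have : (l : ℕ) ≠ 3 := fun h => hl (Fin.ext h)
    have : (l : ℕ) ≠ 2 := fun h => hl2 (Fin.ext h)
    have := l.2; show (l : ℕ) ≤ 1; omega)
  obtain ⟨a, ha, ha1⟩ : ∃ a ∈ (s : Multiset (Fin 4)), a ≠ 1 := by
    by_contra hall
    exact h1 (Sym.eq_replicate_iff.2 fun b hb => by
      by_contra hb1
      exact hall ⟨b, hb, hb1⟩)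
  have ha3 : a ≠ 3 := fun h => h3 (h ▸ ha)
  have ha2 : a ≠ 2 := fun h => h2 (h ▸ ha)
  have ha0 : a = 0 := by
    apply Fin.ext
    have : (a : ℕ) ≠ 3 := fun h => ha3 (Fin.ext h)
    have : (a : ℕ) ≠ 2 := fun h => ha2 (Fin.ext h)
    have : (a : ℕ) ≠ 1 := fun h => ha1 (Fin.ext h)
    have := a.2; show (a : ℕ) = 0; omega
  obtain ⟨t, ht⟩ := Multiset.exists_cons_of_mem ha
  have hct : Multiset.card t = 2 := by
    have hcs : Multiset.card (s : Multiset (Fin 4)) = 3 := Sym.card_coe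
    rw [ht, Multiset.card_cons] at hcs; omega
  have h3t : (3 : Fin 4) ∉ t := fun h => h3 (by rw [ht]; exact Multiset.mem_cons_of_mem h)
  have h2t : (2 : Fin 4) ∉ t := fun h => h2 (by rw [ht]; exact Multiset.mem_cons_of_mem h)
  have hsum : (t.map d).sum ≤ 2 * d 1 := by
    have h := Multiset.sum_le_card_nsmul (t.map d) (d 1) (by
      intro x hx
      obtain ⟨l, hl, rfl⟩ := Multiset.mem_map.mp hx
      exact hle1 l (fun h => h3t (h ▸ hl)) (fun h => h2t (h ▸ hl)))
    simpa [hct] using h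
  subst ha0
  rw [ht, Multiset.map_cons, Multiset.sum_cons]; omega

/-- Conversely, in the chamber `3d₁ < 2d₀ + d₂` of a window-ordered support: a `3` or a `2` in the slot, or the slot `{1,1,1}`, gives exponent `≥ 3d₁`. [folklore] -/
theorem sym_sum_ge_three_d1 (d : Fin 4 → ℕ) (hd : StrictMono d) (hwin : 3 * d 2 < d 3) (hch : 3 * d 1 < 2 * d 0 + d 2) (s : Sym (Fin 4) 3)
    (h : (3 : Fin 4) ∈ (s : Multiset (Fin 4)) ∨ (2 : Fin 4) ∈ (s : Multiset (Fin 4)) ∨ s = Sym.replicate 3 1) :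
    3 * d 1 ≤ ((s : Multiset (Fin 4)).map d).sum := by
  have h12 : d 1 < d 2 := hd (by decide)
  have hle0 : ∀ l : Fin 4, d 0 ≤ d l := fun l => hd.monotone (Fin.zero_le l)
  rcases h with h | h | h
  · have := sym_sum_ge_mid_of_top_mem d hd s h; omega
  · obtain ⟨t, ht⟩ := Multiset.exists_cons_of_mem h
    have hct : Multiset.card t = 2 := by
      have hcs : Multiset.card (s : Multiset (Fin 4)) = 3 := Sym.card_coe
      rw [ht, Multiset.card_cons] at hcs; omega
    have ht0 : 2 * d 0 ≤ (t.map d).sum := by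
      have h := Multiset.card_nsmul_le_sum (s := t.map d) (a := d 0) (by
        intro x hx; obtain ⟨l, -, rfl⟩ := Multiset.mem_map.mp hx; exact hle0 l)
      simpa [hct] using h
    rw [ht, Multiset.map_cons, Multiset.sum_cons]; omega
  · subst h
    simp only [Sym.coe_replicate, Multiset.map_replicate, Multiset.sum_replicate, smul_eq_mul]; exact le_refl _

/-- Slots below `2d₃ + d₁`: at most one `3`, or the slot `{3,3,0}`. [folklore] -/
theorem sym_sum_lt_topMiddle (d : Fin 4 → ℕ) (hd : StrictMono d) (hwin : 3 * d 2 < d 3) (s : Sym (Fin 4) 3)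
    (h : Multiset.count (3 : Fin 4) (s : Multiset (Fin 4)) ≤ 1 ∨ (s : Multiset (Fin 4)) = {3, 3, 0}) :
    ((s : Multiset (Fin 4)).map d).sum < 2 * d 3 + d 1 := by
  have h01 : d 0 < d 1 := hd (by decide)
  rcases h with h | h
  · have := sym_sum_le_of_count_top_le_one d hd s h; omega
  · rw [h]
    simp only [Multiset.insert_eq_cons, Multiset.map_cons, Multiset.sum_cons, Multiset.map_singleton, Multiset.sum_singleton]
    omega

/-- Conversely: two `3`s and not the slot `{3,3,0}` give exponent `≥ 2d₃ + d₁`. [folklore] -/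
theorem sym_sum_ge_topMiddle (d : Fin 4 → ℕ) (hd : StrictMono d) (s : Sym (Fin 4) 3)
    (h2 : 2 ≤ Multiset.count (3 : Fin 4) (s : Multiset (Fin 4))) (hne : (s : Multiset (Fin 4)) ≠ {3, 3, 0}) :
    2 * d 3 + d 1 ≤ ((s : Multiset (Fin 4)).map d).sum := by
  have hle1 : ∀ l : Fin 4, l ≠ 0 → d 1 ≤ d l := fun l hl => hd.monotone (by
    have : (l : ℕ) ≠ 0 := fun h => hl (Fin.ext h)
    show (1 : ℕ) ≤ (l : ℕ); omega)
  have h3mem : (3 : Fin 4) ∈ (s : Multiset (Fin 4)) := Multiset.count_pos.mp (by omega)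
  obtain ⟨t, ht⟩ := Multiset.exists_cons_of_mem h3mem
  have hct1 : 1 ≤ Multiset.count (3 : Fin 4) t := by
    rw [ht, Multiset.count_cons_self] at h2; omega
  have h3t : (3 : Fin 4) ∈ t := Multiset.count_pos.mp (by omega)
  obtain ⟨u, hu⟩ := Multiset.exists_cons_of_mem h3t
  have hcu : Multiset.card u = 1 := by
    have hcs : Multiset.card (s : Multiset (Fin 4)) = 3 := Sym.card_coe
    rw [ht, Multiset.card_cons, hu, Multiset.card_cons] at hcs; omega
  obtain ⟨a, hua⟩ := Multiset.card_eq_one.mp hcu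
  have ha0 : a ≠ 0 := by
    intro ha0; subst ha0
    apply hne
    rw [ht, hu, hua]
    decide
  have hda : d 1 ≤ d a := hle1 a ha0
  rw [ht, hu, hua, Multiset.map_cons, Multiset.sum_cons, Multiset.map_cons, Multiset.sum_cons, Multiset.map_singleton, Multiset.sum_singleton]
  omega

/-! ## 2. The two ranks -/

/-- The slots below `3d₁` in the chamber: `3` of them. [folklore] -/
theorem card_slots_below_three_d1 :
    (((Finset.univ : Finset (Sym (Fin 4) 3)).erase (Sym.replicate 3 3)).filter
      (fun s : Sym (Fin 4) 3 => (3 : Fin 4) ∉ (s : Multiset (Fin 4)) ∧ (2 : Fin 4) ∉ (s : Multiset (Fin 4)) ∧ s ≠ Sym.replicate 3 1)).card = 3 := by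
  decide

/-- The slots below `2d₃ + d₁`: `17` of them. [folklore] -/
theorem card_slots_below_topMiddle :
    (((Finset.univ : Finset (Sym (Fin 4) 3)).erase (Sym.replicate 3 3)).filter
      (fun s : Sym (Fin 4) 3 => Multiset.count (3 : Fin 4) (s : Multiset (Fin 4)) ≤ 1 ∨ (s : Multiset (Fin 4)) = {3, 3, 0})).card = 17 := by
  decide

/-- **`ρ(3d₁) = 3`** in the chamber `3d₁ < 2d₀ + d₂` of a window-ordered support (null-top eighteen). [folklore] -/
theorem sheetRank_coreMiddle_of_chamber (d : Fin 4 → ℕ) (hd : StrictMono d) (hwin : 3 * d 2 < d 3) (hch : 3 * d 1 < 2 * d 0 + d 2)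
    (S : Fin 4 → Matrix (Fin 3) (Fin 3) ℝ) (h3 : (S 3).det = 0)
    (h18 : 18 ≤ ((Matrix.det (∑ l, ((X : ℝ[X]) ^ d l) • (S l).map C)).roots.toFinset.filter (fun t => 0 < t)).card) :
    ((Matrix.det (∑ l, ((X : ℝ[X]) ^ d l) • (S l).map C)).support.filter (· < 3 * d 1)).card = 3 := by
  classical
  have hinj := sym_sum_injOn_of_nullTop_eighteen d S h3 h18
  set E := (Finset.univ : Finset (Sym (Fin 4) 3)).erase (Sym.replicate 3 3) with hE
  set σ : Sym (Fin 4) 3 → ℕ := fun s => ((s : Multiset (Fin 4)).map d).sum with hσ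
  have hfilt : (Matrix.det (∑ l, ((X : ℝ[X]) ^ d l) • (S l).map C)).support.filter (· < 3 * d 1)
      = (E.filter (fun s : Sym (Fin 4) 3 => (3 : Fin 4) ∉ (s : Multiset (Fin 4)) ∧ (2 : Fin 4) ∉ (s : Multiset (Fin 4)) ∧
          s ≠ Sym.replicate 3 1)).image σ := by
    rw [support_det_pencil_eq_of_nullTop_eighteen d S h3 h18]
    ext c
    simp only [Finset.mem_filter, Finset.mem_image]
    constructor
    · rintro ⟨⟨s, hs, rfl⟩, hlt⟩
      refine ⟨s, ⟨hs, ?_, ?_, ?_⟩, rfl⟩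
      · intro hmem
        exact absurd hlt (not_lt.mpr (sym_sum_ge_three_d1 d hd hwin hch s (Or.inl hmem)))
      · intro hmem
        exact absurd hlt (not_lt.mpr (sym_sum_ge_three_d1 d hd hwin hch s (Or.inr (Or.inl hmem))))
      · intro heq
        exact absurd hlt (not_lt.mpr (sym_sum_ge_three_d1 d hd hwin hch s (Or.inr (Or.inr heq))))
    · rintro ⟨s, ⟨hs, hn3, hn2, hne⟩, rfl⟩
      exact ⟨⟨s, hs, rfl⟩, sym_sum_lt_three_d1 d hd s hn3 hn2 hne⟩
  rw [hfilt, Finset.card_image_of_injOn (hinj.mono (by intro s hs; exact (Finset.mem_filter.mp hs).1))]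
  exact card_slots_below_three_d1

/-- **`ρ(2d₃ + d₁) = 17`** on a window-ordered support (null-top eighteen). [folklore] -/
theorem sheetRank_topMiddle_of_windowOrdered (d : Fin 4 → ℕ) (hd : StrictMono d) (hwin : 3 * d 2 < d 3) (S : Fin 4 → Matrix (Fin 3) (Fin 3) ℝ)
    (h3 : (S 3).det = 0)
    (h18 : 18 ≤ ((Matrix.det (∑ l, ((X : ℝ[X]) ^ d l) • (S l).map C)).roots.toFinset.filter (fun t => 0 < t)).card) :
    ((Matrix.det (∑ l, ((X : ℝ[X]) ^ d l) • (S l).map C)).support.filter (· < 2 * d 3 + d 1)).card = 17 := by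
  classical
  have hinj := sym_sum_injOn_of_nullTop_eighteen d S h3 h18
  set E := (Finset.univ : Finset (Sym (Fin 4) 3)).erase (Sym.replicate 3 3) with hE
  set σ : Sym (Fin 4) 3 → ℕ := fun s => ((s : Multiset (Fin 4)).map d).sum with hσ
  have hfilt : (Matrix.det (∑ l, ((X : ℝ[X]) ^ d l) • (S l).map C)).support.filter (· < 2 * d 3 + d 1)
      = (E.filter (fun s : Sym (Fin 4) 3 => Multiset.count (3 : Fin 4) (s : Multiset (Fin 4)) ≤ 1 ∨
          (s : Multiset (Fin 4)) = {3, 3, 0})).image σ := by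
    rw [support_det_pencil_eq_of_nullTop_eighteen d S h3 h18]
    ext c
    simp only [Finset.mem_filter, Finset.mem_image]
    constructor
    · rintro ⟨⟨s, hs, rfl⟩, hlt⟩
      refine ⟨s, ⟨hs, ?_⟩, rfl⟩
      by_contra hq
      push Not at hq
      obtain ⟨hcnt, hne⟩ := hq
      exact absurd hlt (not_lt.mpr (sym_sum_ge_topMiddle d hd s (by omega) hne))
    · rintro ⟨s, ⟨hs, hq⟩, rfl⟩
      exact ⟨⟨s, hs, rfl⟩, sym_sum_lt_topMiddle d hd hwin s hq⟩
  rw [hfilt, Finset.card_image_of_injOn (hinj.mono (by intro s hs; exact (Finset.mem_filter.mp hs).1))]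
  exact card_slots_below_topMiddle

/-! ## 3. The law for the middle letter -/

/-- **WINDOW-ORDERED, CHAMBER `3d₁ < 2d₀ + d₂`, INDEFINITE TOP ⇒ NON-DEFINITE MIDDLE LETTER.** [folklore] -/
theorem card_posRoots_le_17_of_windowOrdered_chamber_indefTop_definiteMiddle (d : Fin 4 → ℕ) (hd : StrictMono d) (hwin : 3 * d 2 < d 3)
    (hch : 3 * d 1 < 2 * d 0 + d 2) (S : Fin 4 → Matrix (Fin 3) (Fin 3) ℝ) (h3 : (S 3).det = 0) (hcell : (-(S 3).adjugate).PosSemidef)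
    (h1 : (S 1).PosDef ∨ (-S 1).PosDef) :
    ((Matrix.det (∑ l, ((X : ℝ[X]) ^ d l) • (S l).map C)).roots.toFinset.filter (fun t => 0 < t)).card ≤ 17 := by
  by_contra hlt
  have h18 : 18 ≤ ((Matrix.det (∑ l, ((X : ℝ[X]) ^ d l) • (S l).map C)).roots.toFinset.filter (fun t => 0 < t)).card := by omega
  set ρ : ℕ → ℕ := fun e => ((Matrix.det (∑ l, ((X : ℝ[X]) ^ d l) • (S l).map C)).support.filter (· < e)).card with hρ
  obtain ⟨-, t1⟩ := top_test_of_nullTop_eighteen d hd S h3 (by decide : (1 : Fin 4) ≠ 3) h1 h18 ρ (fun e => rfl)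
  have w := t1 hcell
  have r0 : ρ (3 * d 1) = 3 := sheetRank_coreMiddle_of_chamber d hd hwin hch S h3 h18
  have r2 : ρ (2 * d 3 + d 1) = 17 := sheetRank_topMiddle_of_windowOrdered d hd hwin S h3 h18
  rw [r0, r2] at w
  omega

/-- **On the rails `3d₁ < 2d₀ + d₂`, `3d₂ < d₃` a null-top eighteen with INDEFINITE top letter has `S₀` and `S₁` both non-definite.** [folklore] -/
theorem card_posRoots_le_17_of_windowOrdered_chamber_indefTop_definiteLow (d : Fin 4 → ℕ) (hd : StrictMono d) (hwin : 3 * d 2 < d 3)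
    (hch : 3 * d 1 < 2 * d 0 + d 2) (S : Fin 4 → Matrix (Fin 3) (Fin 3) ℝ) (h3 : (S 3).det = 0) (hcell : (-(S 3).adjugate).PosSemidef)
    (a : Fin 4) (ha : a = 0 ∨ a = 1) (hdef : (S a).PosDef ∨ (-S a).PosDef) :
    ((Matrix.det (∑ l, ((X : ℝ[X]) ^ d l) • (S l).map C)).roots.toFinset.filter (fun t => 0 < t)).card ≤ 17 := by
  rcases ha with rfl | rfl
  · exact card_posRoots_le_17_of_windowOrdered_indefTop_definiteBottom d hd hwin S h3 hcell hdef
  · exact card_posRoots_le_17_of_windowOrdered_chamber_indefTop_definiteMiddle d hd hwin hch S h3 hcell hdef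

end Summit.ValiantsHypothesis.ValiantsHypothesis.Theorems.LacunarySymmetroidMatrixDescartes.Census
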